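/-
Copyright (c) 2026. Released under the Apache 2.0 license.
-/
import Literature.NumberTheory.EllipticCurves.ModularCurve
import Literature.NumberTheory.EllipticCurves.QuadraticTwist
import Literature.NumberTheory.EllipticCurves.Isogeny
import Literature.NumberTheory.EllipticCurves.GlobalMinimalModel
import Literature.NumberTheory.EllipticCurves.Tamagawa
import Literature.NumberTheory.EllipticCurves.KellerYin2024.PotentiallyGoodOrdinaryPConverse
import Literature.NumberTheory.DiophantineGeometry.Conductor
import Mathlib.GroupTheory.Index
import HarnessLib

/-!
# The Néron scalar of a `p`-isogeny at an additive, potentially supersingular prime is decided by the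
# minimal discriminants (Gealy–Klagsbrun 2017, Thm. 1, `K = ℚ_p`)

The source. M. Gealy, Z. Klagsbrun, *On a local invariant of elliptic curves with a `p`-isogeny* (arXiv:1703.02148, 2017;
bib key `GealyKlagsbrun2017`; held: `paper:arxiv-1703.02148`, p. 3), setting: `K` a `p`-adic field, `E/K` with a cyclic
`p`-isogeny `φ : E → E′`, `α_{φ/K} := |φ^*ω′/ω|_K^{-1}` for MINIMAL invariant differentials `ω`, `ω′` of `E`, `E′`
("the only information intrinsic to the curve is the valuation of `φ^*ω′/ω`").  **Theorem 1**, verbatim: "Suppose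
that `K/ℚ_p` is unramified and `E/K` has additive, potentially supersingular reduction. … Equivalently,
`v_min(E/K) ≠ v_min(E′/K)` and `α_{φ/K} = 1` if `v_min(E/K) < v_min(E′/K)`, `p^{deg K}` if `v_min(E/K) > v_min(E′/K)`,
where `v_min(E/K)` and `v_min(E′/K)` are the valuations of the discriminants of minimal models of `E` and `E′`
respectively."  (Remark 1.2: this completes, for unramified `K`, the characterisation of `α_{φ/K}` begun by
Dokchitser–Dokchitser, *Local invariants of isogenous elliptic curves*, Trans. AMS 367 (2015), Table 1 / Lemma 12 /
Props 15–18, who settle the (potentially) multiplicative and (potentially) good ORDINARY rows.)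

## What is transcribed, and how (cell `bsd-f2-manin`, row E-imc-11 = the cell's «THEOREM T1», placed IN PRINT by
## refuter-2 R-imc-7 and accepted by the planner-of-record 17:43Z: «type it as a Literature fact, Manin form later»)

ONE named fact: Theorem 1 at `K = ℚ_p` (`deg K = 1`) for a `ℚ`-RATIONAL `p`-isogeny between GLOBALLY MINIMAL models
over `ℚ`, in the tree's LATTICE vocabulary.  Reading (recorded for the reviewer): let `W`, `W₂` be globally minimal
with Néron period pairs `L`, `L₂` (`IsNeronLatticeOf`: the lattices of the invariant differentials, which for globally
minimal models are the Néron differentials and are minimal at every `p`); an integer `α` with `α·Λ_W ⊆ Λ_{W₂}` IS a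
`ℚ`-isogeny `φ_α : z ↦ αz` (tree theorem `isIsogenous_of_forall_mul_mem_lattice`; every `ℚ`-isogeny arises so with
`α ∈ ℤ` by the tree theorem `integral_neronScaling_of_isGloballyMinimal_holds`) with `φ_α^* ω_{W₂} = α·ω_W`, so
`α_{φ_α/ℚ_p} = p^{v_p(α)}`; its degree is the index `[Λ_{W₂} : αΛ_W]` (Mathlib `AddSubgroup.relIndex`), and a
`p`-isogeny (degree `p`, prime) is automatically cyclic.  «`E/ℚ_p` additive» = neither good nor multiplicative
reduction at `p` (tree `HasGoodReductionAtPrime` / `HasMultiplicativeReductionAtPrime`, model-independent);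
«potentially supersingular» = potentially good (`0 ≤ v_p(j)`, Silverman AEC VII.5.5) and NOT potentially good
ordinary (tree `HasPotentiallyGoodOrdinaryReductionAtPrime`).  `v_min` = `padicValInt p (minimalDiscriminantInt ·)`.
CONCLUSION as printed: `v_p Δ_min(W) ≠ v_p Δ_min(W₂)`; `v_p Δ_min(W) < v_p Δ_min(W₂) ⇒ p ∤ α` (`α_φ = 1`);
`v_p Δ_min(W) > v_p Δ_min(W₂) ⇒ p ∥ α` (`α_φ = p`).  `TODO(general form)`: `K/ℚ_p` unramified of degree `n`
(`p^n`); Theorem 2 (partial converse for ramified `K`); the Dokchitser–Dokchitser rows (multiplicative /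
potentially multiplicative / potentially good ordinary), which the cell's census reads the same way.

Cell context (why it is wanted): in MANIN form (`D₂ = φ ∘ D₀` for the lattice-optimal `X₀(N)`-datum `D₀`:
`c(D₂) = α·c(D₀)`) this is the theorem-side input of the isogeny-edge laws `RootEdgeGainOnlyByDrop` /
`RelativeManinTrivialityGeFive` (leaf `Summits/…/ManinAdditive/IsogenyEdgeLaws.lean`): along a potentially-good
`Δ_min`-DROP out of the optimal curve the Manin `p`-part grows by exactly one, along a RISE it does not (census
HOME/MEMO-imc.md §11.3: 99 / 99 drops with gain 1, 305 446 / 305 446 rises with gain 0, `N < 5·10⁵`).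

## References
* [GealyKlagsbrun2017] op. cit., Thm. 1 (p. 3), Remarks 1.1–1.2, Lemma 3.1 / Cor. 3.2 (p. 6).
* [DokchitserDokchitser2015LocalInvariants] T. and V. Dokchitser, Trans. AMS 367 (2015), Table 1, Lemma 12,
  Props 15–18.
* [SilvermanAEC2009] AEC VII.5.5 (potential good reduction ⟺ `j` integral).
* [SilvermanATAEC1994] ATAEC IV.5.1, IV.6.1, Cor. IV.9.1 (Néron mapping property; minimal model = identity
  component of the Néron model).
-/

noncomputable section

namespace Literature.NumberTheory.EllipticCurves

open _root_.WeierstrassCurve ModularForms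

/-- **Gealy–Klagsbrun 2017, Theorem 1 at `K = ℚ_p`, lattice form.**  Let `W`, `W₂` be globally minimal elliptic curves
over `ℚ` with Néron period pairs `L`, `L₂`, and `α ∈ ℤ` with `α·Λ_W ⊆ Λ_{W₂}` of index `p` (the `ℚ`-isogeny
`z ↦ αz : ℂ/Λ_W → ℂ/Λ_{W₂}` is a cyclic `p`-isogeny pulling the Néron differential of `W₂` back to `α` times that of
`W`).  If `W` has ADDITIVE, POTENTIALLY SUPERSINGULAR reduction at `p` (neither good nor multiplicative; `v_p(j) ≥ 0`;
not potentially good ordinary), then `v_p Δ_min(W) ≠ v_p Δ_min(W₂)`, and `v_p Δ_min(W) < v_p Δ_min(W₂) ⇒ p ∤ α`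
(`α_φ = 1`), `v_p Δ_min(W) > v_p Δ_min(W₂) ⇒ p ∥ α` (`α_φ = p`).
[cite: GealyKlagsbrun2017, Thm. 1 (K = ℚ_p; lattice reading of α_φ in the module docstring)]
[cite: DokchitserDokchitser2015LocalInvariants, Lemma 12 and Table 1 (the invariant α_φ)] -/
def gealyKlagsbrun2017_neronScalar_of_additive_potSupersingular : Prop :=
  ∀ (W W₂ : WeierstrassCurve ℚ) [W.IsElliptic] [W.IsGloballyMinimal] [W₂.IsElliptic]
    [W₂.IsGloballyMinimal] (p : ℕ) [Fact p.Prime] (L L₂ : PeriodPair) (α : ℤ),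
    IsNeronLatticeOf (W.baseChange ℂ) L → IsNeronLatticeOf (W₂.baseChange ℂ) L₂ →
    (∀ z ∈ L.lattice, (α : ℂ) * z ∈ L₂.lattice) →
    (L.lattice.toAddSubgroup.map (AddMonoidHom.mulLeft (α : ℂ))).relIndex L₂.lattice.toAddSubgroup = p →
    ¬ W.HasGoodReductionAtPrime p → ¬ W.HasMultiplicativeReductionAtPrime p →
    0 ≤ padicValRat p W.j → ¬ W.HasPotentiallyGoodOrdinaryReductionAtPrime p →
    padicValInt p W.minimalDiscriminantInt ≠ padicValInt p W₂.minimalDiscriminantInt ∧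
      (padicValInt p W.minimalDiscriminantInt < padicValInt p W₂.minimalDiscriminantInt →
        ¬ (p : ℤ) ∣ α) ∧
      (padicValInt p W₂.minimalDiscriminantInt < padicValInt p W.minimalDiscriminantInt →
        (p : ℤ) ∣ α ∧ ¬ (p : ℤ) ^ 2 ∣ α)

end Literature.NumberTheory.EllipticCurves
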